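import Summits.Ventures.Crystal3D.Theorems.StickyWulffConstantGenericWallFloorSlotGeometry
import Summits.Ventures.Crystal3D.Theorems.StickyWulffConstantGenericWallFloorBandInequalities
import HarnessLib

/-!
# The band lemma: at most six slots of the fcc kissing shell have height `|⟪w, ν⟫| ≤ √2 − 1`

HONEST FRAMING. Part of the venture `Summits/Ventures/Crystal3D` (cell `crystal3d-full`), helper for the
crux `GenericWallFloor` (stmt-Ventures-19480) of `route-Ventures-StickyWulffConstant`, line `WallLedgerG`,
rigid-bicrystal rung of `stub_twoSlabAdhesion` (note RIGID-RUNG-ARCH on the item): the FLOOR EXTRAS of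
the clamped cell (balls of the second grain trapped within `√2 − 1` of the cylinder floor) have all their
own-lattice neighbours in a height band of length `√2 − 1`, hence at most six of them (this file), hence pay
for the outer ends they consume (`12 − m − 2c ≥ 12 − 6 − 6 ≥ 0`).  Pure slot geometry; nothing about
packings.

**Theorem** (`card_le_six_of_slots_small_height`).  A finite set of unit vectors of
`Λ₀ = fccStacking 1 √(2/3)` all with `|⟪w, ν⟫| ≤ √2 − 1` (`ν` unit) has at most six elements.
Proof: cubic coordinates (`…SlotGeometry`) put every slot in one of six antipodal axis classes
`(σ, ±σ, 0)`, `(σ, 0, ±σ)`, `(0, σ, ±σ)`; a class holds at most two slots (`slotClass_card_le_pos/neg`)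
and is empty unless its pair height is small; at most three pair heights are small
(`…BandInequalities`: `sum_six_indicators_le_three`).

WHAT THIS IS NOT: any statement about packings or the crux stub; rung F-C1 not moved.
-/

noncomputable section

namespace Summit.Ventures.Crystal3D.Theorems

open Summit.Ventures.Crystal3D Finset
open Literature.MathematicalPhysics.StatisticalMechanics (barlowPos fccStacking constHagg haggLabel_const
  barlowPos_mem)
open scoped InnerProductSpace

/-- If a real-valued function `f` is injective on `F` and takes values in `{1, −1}` on `F`, then
`#F ≤ 2`. -/
theorem card_le_two_of_injOn_pm_one {F : Finset (EuclideanSpace ℝ (Fin 3))}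
    (f : EuclideanSpace ℝ (Fin 3) → ℝ) (hf : ∀ w ∈ F, f w = 1 ∨ f w = -1) (hinj : Set.InjOn f ↑F) :
    F.card ≤ 2 := by
  classical
  have h := Finset.card_le_card_of_injOn f (fun w hw => ?_) hinj (t := ({(1 : ℝ), -1} : Finset ℝ))
  · calc F.card ≤ ({(1 : ℝ), -1} : Finset ℝ).card := h
      _ ≤ 2 := Finset.card_le_two
  · have hw' := Finset.mem_coe.1 hw
    rcases hf w hw' with h | h <;> simp [h]

/-- **One axis class** (class `F = G`): for a finite set `W` of slots with integer cubic-type coordinates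
`(Z, F, G)` (`Σ σ² = 2`, heights `2⟪w,ν⟫ = σZ cZ + σF cF + σG cG`, all `|⟪w,ν⟫| ≤ √2 − 1`), the members
with `Z = 0`, `F w = G w` number at most two, and none at all unless `|cF + cG| ≤ 2(√2 − 1)`. -/
theorem slotClass_card_le_pos (ν : EuclideanSpace ℝ (Fin 3)) (W : Finset (EuclideanSpace ℝ (Fin 3)))
    (Z F G : EuclideanSpace ℝ (Fin 3) → ℝ) (cZ cF cG : ℝ)
    (hinj : ∀ w ∈ W, ∀ w' ∈ W, Z w = Z w' → F w = F w' → G w = G w' → w = w')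
    (hslot : ∀ w ∈ W, ∃ σZ σF σG : ℤ, σZ ^ 2 + σF ^ 2 + σG ^ 2 = 2 ∧ Z w = σZ ∧ F w = σF ∧ G w = σG ∧
      2 * ⟪w, ν⟫_ℝ = σZ * cZ + σF * cF + σG * cG)
    (hband : ∀ w ∈ W, |⟪w, ν⟫_ℝ| ≤ Real.sqrt 2 - 1) :
    (W.filter fun w => Z w = 0 ∧ F w = G w).card ≤ 2 * (if |cF + cG| ≤ 2 * (Real.sqrt 2 - 1) then 1 else 0) := by
  classical
  -- on the class: `F w = ±1` and `2⟪w,ν⟫ = F w · (cF + cG)`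
  have key : ∀ w ∈ W.filter (fun w => Z w = 0 ∧ F w = G w),
      (F w = 1 ∨ F w = -1) ∧ 2 * ⟪w, ν⟫_ℝ = F w * (cF + cG) := by
    intro w hw
    rw [Finset.mem_filter] at hw
    obtain ⟨hwW, hZ0, hFG⟩ := hw
    obtain ⟨σZ, σF, σG, hσ, hZ, hF, hG, hin⟩ := hslot w hwW
    have eZ : (σZ : ℝ) = 0 := by rw [← hZ]; exact hZ0
    have eF : (σF : ℝ) = σG := by rw [← hF, ← hG]; exact hFG
    have hσR : (σZ : ℝ) ^ 2 + (σF : ℝ) ^ 2 + (σG : ℝ) ^ 2 = 2 := by exact_mod_cast hσ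
    have hF2 : (σF : ℝ) ^ 2 = 1 := by
      have : (σF : ℝ) ^ 2 = (σG : ℝ) ^ 2 := by rw [eF]; try ring
      nlinarith
    have hFpm : (σF : ℝ) = 1 ∨ (σF : ℝ) = -1 := by
      have h0 : ((σF : ℝ) - 1) * ((σF : ℝ) + 1) = 0 := by ring_nf; linarith
      rcases mul_eq_zero.1 h0 with h | h
      · left; linarith
      · right; linarith
    refine ⟨by rw [hF]; exact hFpm, ?_⟩
    rw [hin, hF, eZ]
    have eG : (σG : ℝ) = (σF : ℝ) := by rw [eF]
    rw [eG]; ring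
  split_ifs with hsmall
  · -- at most two: `F` is injective on the class with values in `{1, −1}`
    refine (card_le_two_of_injOn_pm_one F (fun w hw => (key w hw).1) ?_).trans (by norm_num)
    intro w hw w' hw' hww'
    rw [Finset.mem_coe, Finset.mem_filter] at hw hw'
    refine hinj w hw.1 w' hw'.1 (by rw [hw.2.1, hw'.2.1]) hww' ?_
    rw [← hw.2.2, ← hw'.2.2]; exact hww'
  · -- empty
    rw [mul_zero, Nat.le_zero, Finset.card_eq_zero, Finset.eq_empty_iff_forall_notMem]
    intro w hw
    apply hsmall
    obtain ⟨hpm, hval⟩ := key w hw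
    have hb := hband w (Finset.mem_filter.1 hw).1
    have habs : |cF + cG| = 2 * |⟪w, ν⟫_ℝ| := by
      have : |F w| = 1 := by rcases hpm with h | h <;> rw [h] <;> norm_num
      calc |cF + cG| = |F w| * |cF + cG| := by rw [this, one_mul]
        _ = |F w * (cF + cG)| := (abs_mul _ _).symm
        _ = |2 * ⟪w, ν⟫_ℝ| := by rw [hval]
        _ = 2 * |⟪w, ν⟫_ℝ| := by rw [abs_mul]; norm_num
    rw [habs]; linarith

/-- **One axis class** (class `F = −G`): for a finite set `W` of slots with integer cubic-type coordinates
`(Z, F, G)` (`Σ σ² = 2`, heights `2⟪w,ν⟫ = σZ cZ + σF cF + σG cG`, all `|⟪w,ν⟫| ≤ √2 − 1`), the members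
with `Z = 0`, `F w = -G w` number at most two, and none at all unless `|cF - cG| ≤ 2(√2 − 1)`. -/
theorem slotClass_card_le_neg (ν : EuclideanSpace ℝ (Fin 3)) (W : Finset (EuclideanSpace ℝ (Fin 3)))
    (Z F G : EuclideanSpace ℝ (Fin 3) → ℝ) (cZ cF cG : ℝ)
    (hinj : ∀ w ∈ W, ∀ w' ∈ W, Z w = Z w' → F w = F w' → G w = G w' → w = w')
    (hslot : ∀ w ∈ W, ∃ σZ σF σG : ℤ, σZ ^ 2 + σF ^ 2 + σG ^ 2 = 2 ∧ Z w = σZ ∧ F w = σF ∧ G w = σG ∧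
      2 * ⟪w, ν⟫_ℝ = σZ * cZ + σF * cF + σG * cG)
    (hband : ∀ w ∈ W, |⟪w, ν⟫_ℝ| ≤ Real.sqrt 2 - 1) :
    (W.filter fun w => Z w = 0 ∧ F w = -G w).card ≤ 2 * (if |cF - cG| ≤ 2 * (Real.sqrt 2 - 1) then 1 else 0) := by
  classical
  -- on the class: `F w = ±1` and `2⟪w,ν⟫ = F w · (cF - cG)`
  have key : ∀ w ∈ W.filter (fun w => Z w = 0 ∧ F w = -G w),
      (F w = 1 ∨ F w = -1) ∧ 2 * ⟪w, ν⟫_ℝ = F w * (cF - cG) := by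
    intro w hw
    rw [Finset.mem_filter] at hw
    obtain ⟨hwW, hZ0, hFG⟩ := hw
    obtain ⟨σZ, σF, σG, hσ, hZ, hF, hG, hin⟩ := hslot w hwW
    have eZ : (σZ : ℝ) = 0 := by rw [← hZ]; exact hZ0
    have eF : (σF : ℝ) = -(σG : ℝ) := by rw [← hF, ← hG]; exact hFG
    have hσR : (σZ : ℝ) ^ 2 + (σF : ℝ) ^ 2 + (σG : ℝ) ^ 2 = 2 := by exact_mod_cast hσ
    have hF2 : (σF : ℝ) ^ 2 = 1 := by
      have : (σF : ℝ) ^ 2 = (σG : ℝ) ^ 2 := by rw [eF]; try ring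
      nlinarith
    have hFpm : (σF : ℝ) = 1 ∨ (σF : ℝ) = -1 := by
      have h0 : ((σF : ℝ) - 1) * ((σF : ℝ) + 1) = 0 := by ring_nf; linarith
      rcases mul_eq_zero.1 h0 with h | h
      · left; linarith
      · right; linarith
    refine ⟨by rw [hF]; exact hFpm, ?_⟩
    rw [hin, hF, eZ]
    have eG : (σG : ℝ) = -(σF : ℝ) := by rw [eF]; ring
    rw [eG]; ring
  split_ifs with hsmall
  · -- at most two: `F` is injective on the class with values in `{1, −1}`
    refine (card_le_two_of_injOn_pm_one F (fun w hw => (key w hw).1) ?_).trans (by norm_num)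
    intro w hw w' hw' hww'
    rw [Finset.mem_coe, Finset.mem_filter] at hw hw'
    refine hinj w hw.1 w' hw'.1 (by rw [hw.2.1, hw'.2.1]) hww' ?_
    have e := hww'; rw [hw.2.2, hw'.2.2] at e; exact neg_inj.1 e
  · -- empty
    rw [mul_zero, Nat.le_zero, Finset.card_eq_zero, Finset.eq_empty_iff_forall_notMem]
    intro w hw
    apply hsmall
    obtain ⟨hpm, hval⟩ := key w hw
    have hb := hband w (Finset.mem_filter.1 hw).1
    have habs : |cF - cG| = 2 * |⟪w, ν⟫_ℝ| := by
      have : |F w| = 1 := by rcases hpm with h | h <;> rw [h] <;> norm_num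
      calc |cF - cG| = |F w| * |cF - cG| := by rw [this, one_mul]
        _ = |F w * (cF - cG)| := (abs_mul _ _).symm
        _ = |2 * ⟪w, ν⟫_ℝ| := by rw [hval]
        _ = 2 * |⟪w, ν⟫_ℝ| := by rw [abs_mul]; norm_num
    rw [habs]; linarith

/-- **Band lemma.**  A finite set of unit vectors of `Λ₀ = fccStacking 1 √(2/3)` (slots) all of height
`|⟪w, ν⟫| ≤ √2 − 1` with respect to a unit vector `ν` has at most six elements. -/
theorem card_le_six_of_slots_small_height (ν : EuclideanSpace ℝ (Fin 3)) (hν : ‖ν‖ = 1)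
    (W : Finset (EuclideanSpace ℝ (Fin 3)))
    (hW : ∀ w ∈ W, w ∈ fccStacking 1 (Real.sqrt (2 / 3)) ∧ ‖w‖ = 1 ∧
      |⟪w, ν⟫_ℝ| ≤ Real.sqrt 2 - 1) : W.card ≤ 6 := by
  classical
  set a : ℝ := ν 0 + Real.sqrt 3 / 3 * ν 1 - Real.sqrt (2 / 3) * ν 2 with ha
  set b : ℝ := ν 0 - Real.sqrt 3 / 3 * ν 1 + Real.sqrt (2 / 3) * ν 2 with hb
  set c : ℝ := 2 * Real.sqrt 3 / 3 * ν 1 + Real.sqrt (2 / 3) * ν 2 with hc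
  have habc : a ^ 2 + b ^ 2 + c ^ 2 = 2 := by
    have h := two_mul_norm_sq_eq_cubic ν
    rw [hν, one_pow, mul_one] at h
    rw [ha, hb, hc]; linarith
  have hband : ∀ w ∈ W, |⟪w, ν⟫_ℝ| ≤ Real.sqrt 2 - 1 := fun w hw => (hW w hw).2.2
  -- integer cubic coordinates of a slot and its height
  have hslot : ∀ w ∈ W, ∃ σ₁ σ₂ σ₃ : ℤ, σ₁ ^ 2 + σ₂ ^ 2 + σ₃ ^ 2 = 2 ∧
      w 0 + Real.sqrt 3 / 3 * w 1 - Real.sqrt (2 / 3) * w 2 = σ₁ ∧ w 0 - Real.sqrt 3 / 3 * w 1 + Real.sqrt (2 / 3) * w 2 = σ₂ ∧ 2 * Real.sqrt 3 / 3 * w 1 + Real.sqrt (2 / 3) * w 2 = σ₃ ∧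
      2 * ⟪w, ν⟫_ℝ = σ₁ * a + σ₂ * b + σ₃ * c := by
    intro w hw
    obtain ⟨hmem, hn, -⟩ := hW w hw
    obtain ⟨k, i, j, rfl⟩ := hmem
    obtain ⟨hA, hB, hC⟩ := cubic_barlowPos k i j
    refine ⟨i + j, i + k, j + k, ?_, by rw [hA]; push_cast; ring, by rw [hB]; push_cast; ring,
      by rw [hC]; push_cast; ring, ?_⟩
    · have h := two_mul_norm_sq_eq_cubic (barlowPos 1 (Real.sqrt (2 / 3)) constHagg k i j)
      rw [hn, hA, hB, hC] at h
      have : (((i + j) ^ 2 + (i + k) ^ 2 + (j + k) ^ 2 : ℤ) : ℝ) = 2 := by push_cast; linarith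
      exact_mod_cast this
    · rw [inner_eq_half_cubic, hA, hB, hC, ← ha, ← hb, ← hc]; push_cast; ring
  -- the same data in the three coordinate orders `(C,A,B)`, `(B,A,C)`, `(A,B,C)`
  have hsCAB : ∀ w ∈ W, ∃ σZ σF σG : ℤ, σZ ^ 2 + σF ^ 2 + σG ^ 2 = 2 ∧
      2 * Real.sqrt 3 / 3 * w 1 + Real.sqrt (2 / 3) * w 2 = σZ ∧ w 0 + Real.sqrt 3 / 3 * w 1 - Real.sqrt (2 / 3) * w 2 = σF ∧ w 0 - Real.sqrt 3 / 3 * w 1 + Real.sqrt (2 / 3) * w 2 = σG ∧ 2 * ⟪w, ν⟫_ℝ = σZ * c + σF * a + σG * b := by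
    intro w hw; obtain ⟨σ₁, σ₂, σ₃, hσ, hA, hB, hC, hin⟩ := hslot w hw
    exact ⟨σ₃, σ₁, σ₂, by linarith, hC, hA, hB, by rw [hin]; ring⟩
  have hsBAC : ∀ w ∈ W, ∃ σZ σF σG : ℤ, σZ ^ 2 + σF ^ 2 + σG ^ 2 = 2 ∧
      w 0 - Real.sqrt 3 / 3 * w 1 + Real.sqrt (2 / 3) * w 2 = σZ ∧ w 0 + Real.sqrt 3 / 3 * w 1 - Real.sqrt (2 / 3) * w 2 = σF ∧ 2 * Real.sqrt 3 / 3 * w 1 + Real.sqrt (2 / 3) * w 2 = σG ∧ 2 * ⟪w, ν⟫_ℝ = σZ * b + σF * a + σG * c := by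
    intro w hw; obtain ⟨σ₁, σ₂, σ₃, hσ, hA, hB, hC, hin⟩ := hslot w hw
    exact ⟨σ₂, σ₁, σ₃, by linarith, hB, hA, hC, by rw [hin]; ring⟩
  have hsABC : ∀ w ∈ W, ∃ σZ σF σG : ℤ, σZ ^ 2 + σF ^ 2 + σG ^ 2 = 2 ∧
      w 0 + Real.sqrt 3 / 3 * w 1 - Real.sqrt (2 / 3) * w 2 = σZ ∧ w 0 - Real.sqrt 3 / 3 * w 1 + Real.sqrt (2 / 3) * w 2 = σF ∧ 2 * Real.sqrt 3 / 3 * w 1 + Real.sqrt (2 / 3) * w 2 = σG ∧ 2 * ⟪w, ν⟫_ℝ = σZ * a + σF * b + σG * c := by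
    intro w hw; obtain ⟨σ₁, σ₂, σ₃, hσ, hA, hB, hC, hin⟩ := hslot w hw
    exact ⟨σ₁, σ₂, σ₃, hσ, hA, hB, hC, hin⟩
  -- injectivity of cubic coordinates in the three orders
  have hiCAB : ∀ w ∈ W, ∀ w' ∈ W, 2 * Real.sqrt 3 / 3 * w 1 + Real.sqrt (2 / 3) * w 2 = 2 * Real.sqrt 3 / 3 * w' 1 + Real.sqrt (2 / 3) * w' 2 → w 0 + Real.sqrt 3 / 3 * w 1 - Real.sqrt (2 / 3) * w 2 = w' 0 + Real.sqrt 3 / 3 * w' 1 - Real.sqrt (2 / 3) * w' 2 → w 0 - Real.sqrt 3 / 3 * w 1 + Real.sqrt (2 / 3) * w 2 = w' 0 - Real.sqrt 3 / 3 * w' 1 + Real.sqrt (2 / 3) * w' 2 → w = w' :=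
    fun w _ w' _ hC hA hB => eq_of_cubic_eq w w' hA hB hC
  have hiBAC : ∀ w ∈ W, ∀ w' ∈ W, w 0 - Real.sqrt 3 / 3 * w 1 + Real.sqrt (2 / 3) * w 2 = w' 0 - Real.sqrt 3 / 3 * w' 1 + Real.sqrt (2 / 3) * w' 2 → w 0 + Real.sqrt 3 / 3 * w 1 - Real.sqrt (2 / 3) * w 2 = w' 0 + Real.sqrt 3 / 3 * w' 1 - Real.sqrt (2 / 3) * w' 2 → 2 * Real.sqrt 3 / 3 * w 1 + Real.sqrt (2 / 3) * w 2 = 2 * Real.sqrt 3 / 3 * w' 1 + Real.sqrt (2 / 3) * w' 2 → w = w' :=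
    fun w _ w' _ hB hA hC => eq_of_cubic_eq w w' hA hB hC
  have hiABC : ∀ w ∈ W, ∀ w' ∈ W, w 0 + Real.sqrt 3 / 3 * w 1 - Real.sqrt (2 / 3) * w 2 = w' 0 + Real.sqrt 3 / 3 * w' 1 - Real.sqrt (2 / 3) * w' 2 → w 0 - Real.sqrt 3 / 3 * w 1 + Real.sqrt (2 / 3) * w 2 = w' 0 - Real.sqrt 3 / 3 * w' 1 + Real.sqrt (2 / 3) * w' 2 → 2 * Real.sqrt 3 / 3 * w 1 + Real.sqrt (2 / 3) * w 2 = 2 * Real.sqrt 3 / 3 * w' 1 + Real.sqrt (2 / 3) * w' 2 → w = w' :=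
    fun w _ w' _ hA hB hC => eq_of_cubic_eq w w' hA hB hC
  -- the six classes
  have c₁ := slotClass_card_le_pos ν W (fun w => 2 * Real.sqrt 3 / 3 * w 1 + Real.sqrt (2 / 3) * w 2) (fun w => w 0 + Real.sqrt 3 / 3 * w 1 - Real.sqrt (2 / 3) * w 2) (fun w => w 0 - Real.sqrt 3 / 3 * w 1 + Real.sqrt (2 / 3) * w 2) c a b hiCAB hsCAB hband
  have c₂ := slotClass_card_le_neg ν W (fun w => 2 * Real.sqrt 3 / 3 * w 1 + Real.sqrt (2 / 3) * w 2) (fun w => w 0 + Real.sqrt 3 / 3 * w 1 - Real.sqrt (2 / 3) * w 2) (fun w => w 0 - Real.sqrt 3 / 3 * w 1 + Real.sqrt (2 / 3) * w 2) c a b hiCAB hsCAB hband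
  have c₃ := slotClass_card_le_pos ν W (fun w => w 0 - Real.sqrt 3 / 3 * w 1 + Real.sqrt (2 / 3) * w 2) (fun w => w 0 + Real.sqrt 3 / 3 * w 1 - Real.sqrt (2 / 3) * w 2) (fun w => 2 * Real.sqrt 3 / 3 * w 1 + Real.sqrt (2 / 3) * w 2) b a c hiBAC hsBAC hband
  have c₄ := slotClass_card_le_neg ν W (fun w => w 0 - Real.sqrt 3 / 3 * w 1 + Real.sqrt (2 / 3) * w 2) (fun w => w 0 + Real.sqrt 3 / 3 * w 1 - Real.sqrt (2 / 3) * w 2) (fun w => 2 * Real.sqrt 3 / 3 * w 1 + Real.sqrt (2 / 3) * w 2) b a c hiBAC hsBAC hband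
  have c₅ := slotClass_card_le_pos ν W (fun w => w 0 + Real.sqrt 3 / 3 * w 1 - Real.sqrt (2 / 3) * w 2) (fun w => w 0 - Real.sqrt 3 / 3 * w 1 + Real.sqrt (2 / 3) * w 2) (fun w => 2 * Real.sqrt 3 / 3 * w 1 + Real.sqrt (2 / 3) * w 2) a b c hiABC hsABC hband
  have c₆ := slotClass_card_le_neg ν W (fun w => w 0 + Real.sqrt 3 / 3 * w 1 - Real.sqrt (2 / 3) * w 2) (fun w => w 0 - Real.sqrt 3 / 3 * w 1 + Real.sqrt (2 / 3) * w 2) (fun w => 2 * Real.sqrt 3 / 3 * w 1 + Real.sqrt (2 / 3) * w 2) a b c hiABC hsABC hband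
  -- cover: every slot lies in one of the six classes
  set F₁ := W.filter (fun w => 2 * Real.sqrt 3 / 3 * w 1 + Real.sqrt (2 / 3) * w 2 = 0 ∧ w 0 + Real.sqrt 3 / 3 * w 1 - Real.sqrt (2 / 3) * w 2 = w 0 - Real.sqrt 3 / 3 * w 1 + Real.sqrt (2 / 3) * w 2) with hF₁
  set F₂ := W.filter (fun w => 2 * Real.sqrt 3 / 3 * w 1 + Real.sqrt (2 / 3) * w 2 = 0 ∧ w 0 + Real.sqrt 3 / 3 * w 1 - Real.sqrt (2 / 3) * w 2 = -(w 0 - Real.sqrt 3 / 3 * w 1 + Real.sqrt (2 / 3) * w 2)) with hF₂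
  set F₃ := W.filter (fun w => w 0 - Real.sqrt 3 / 3 * w 1 + Real.sqrt (2 / 3) * w 2 = 0 ∧ w 0 + Real.sqrt 3 / 3 * w 1 - Real.sqrt (2 / 3) * w 2 = 2 * Real.sqrt 3 / 3 * w 1 + Real.sqrt (2 / 3) * w 2) with hF₃
  set F₄ := W.filter (fun w => w 0 - Real.sqrt 3 / 3 * w 1 + Real.sqrt (2 / 3) * w 2 = 0 ∧ w 0 + Real.sqrt 3 / 3 * w 1 - Real.sqrt (2 / 3) * w 2 = -(2 * Real.sqrt 3 / 3 * w 1 + Real.sqrt (2 / 3) * w 2)) with hF₄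
  set F₅ := W.filter (fun w => w 0 + Real.sqrt 3 / 3 * w 1 - Real.sqrt (2 / 3) * w 2 = 0 ∧ w 0 - Real.sqrt 3 / 3 * w 1 + Real.sqrt (2 / 3) * w 2 = 2 * Real.sqrt 3 / 3 * w 1 + Real.sqrt (2 / 3) * w 2) with hF₅
  set F₆ := W.filter (fun w => w 0 + Real.sqrt 3 / 3 * w 1 - Real.sqrt (2 / 3) * w 2 = 0 ∧ w 0 - Real.sqrt 3 / 3 * w 1 + Real.sqrt (2 / 3) * w 2 = -(2 * Real.sqrt 3 / 3 * w 1 + Real.sqrt (2 / 3) * w 2)) with hF₆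
  have hcover : W ⊆ F₁ ∪ F₂ ∪ F₃ ∪ F₄ ∪ F₅ ∪ F₆ := by
    intro w hw
    obtain ⟨σ₁, σ₂, σ₃, hσ, hA, hB, hC, -⟩ := hslot w hw
    have hb₁ : -1 ≤ σ₁ ∧ σ₁ ≤ 1 := by constructor <;> nlinarith
    have hb₂ : -1 ≤ σ₂ ∧ σ₂ ≤ 1 := by constructor <;> nlinarith
    have hb₃ : -1 ≤ σ₃ ∧ σ₃ ≤ 1 := by constructor <;> nlinarith
    simp only [Finset.mem_union, hF₁, hF₂, hF₃, hF₄, hF₅, hF₆, Finset.mem_filter, hA, hB, hC]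
    obtain ⟨l₁, u₁⟩ := hb₁; obtain ⟨l₂, u₂⟩ := hb₂; obtain ⟨l₃, u₃⟩ := hb₃
    interval_cases σ₁ <;> interval_cases σ₂ <;> interval_cases σ₃ <;>
      first | (exfalso; norm_num at hσ; done) | (norm_num [hw])
  have u2 := Finset.card_union_le F₁ F₂
  have u3 := Finset.card_union_le (F₁ ∪ F₂) F₃
  have u4 := Finset.card_union_le (F₁ ∪ F₂ ∪ F₃) F₄
  have u5 := Finset.card_union_le (F₁ ∪ F₂ ∪ F₃ ∪ F₄) F₅
  have u6 := Finset.card_union_le (F₁ ∪ F₂ ∪ F₃ ∪ F₄ ∪ F₅) F₆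
  have hcov := Finset.card_le_card hcover
  have hind := sum_six_indicators_le_three (|a + b| ≤ 2 * (Real.sqrt 2 - 1)) (|a - b| ≤ 2 * (Real.sqrt 2 - 1)) (|a + c| ≤ 2 * (Real.sqrt 2 - 1))
    (|a - c| ≤ 2 * (Real.sqrt 2 - 1)) (|b + c| ≤ 2 * (Real.sqrt 2 - 1)) (|b - c| ≤ 2 * (Real.sqrt 2 - 1))
    (not_four_small_heights_B a b c habc) (not_small_ab_bc a b c habc) (not_small_ac_bc a b c habc)
    (not_four_small_heights_A a b c habc) (not_small_ac_A a b c habc) (not_small_bc_A a b c habc)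
  omega

end Summit.Ventures.Crystal3D.Theorems

end
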